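import Summits.QuantumFields.YangMills.Theorems.FradkinShenkerFlowFiniteSusceptibilityWeakCouplingMirrorLogConvex
import Summits.QuantumFields.YangMills.Theorems.FradkinShenkerFlowFiniteSusceptibilityWeakCouplingSplit
import HarnessLib

/-!
# The crux implies STUB 0 of line `purity-rate-split`: monotone mirror functions (item stmt-QuantumFields-9442)

Support file for item stmt-QuantumFields-9442 (route `FradkinShenkerFlow` of `YangMills`), crux
`Summit.QuantumFields.YangMills.Theses.FradkinShenkerFlow.FiniteSusceptibilityWeakCoupling`, line `purity-rate-split`
(`Cruxes/FiniteSusceptibilityWeakCoupling/Lines/purity_rate_split.lean`). That line cuts the crux into STUB 0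
(`stub_noMirrorLongRangeOrder`: at weak coupling no gauge-invariant local observable has long-range order against its own
time-reflected image, uniformly in the odd tori) and STUB 1 (`stub_decorrelationForcesSummability`); the skeleton proves
STUB 0 ∧ STUB 1 ⇒ crux and crux ⇒ STUB 1. This file proves **crux ⇒ STUB 0**, so the cut is LOSSLESS
(`finiteSusceptibilityWeakCoupling_iff_subs : crux ↔ Sub₀ ∧ Sub₁` for the landed `finiteSusceptibilityWeakCoupling_of_subs`).
Everything holds for every compact `G` and every `β ≥ 0`; reflection positivity only (`…MirrorLogConvex.lean`).

Write `L = 2S+1`, `D_A(m) = ⟨A · τ_{m e₀}(A∘Θ)⟩_{β,L} − ⟨A⟩⟨A∘Θ⟩`, `R` the time extent of `supp A`.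

* `MirrorMonotone.antitone_step_of_logConvex_symm` — a non-negative, step-one log-convex sequence on `[a, L−a]` symmetric
  about `L/2` is NON-INCREASING on `[a, S]` (a strict increase would propagate to `E(S) < E(S+1) = E(S)`);
* `MirrorMonotone.mirrorDecorrelation_of_fsClause` — with `E(m) = D_A(m) + D_A(L−m)` (non-negative, log-convex, symmetric by
  `…MirrorLogConvex`), the crux's clause at `β` for the pairs `(A, Aᴿ)`, `(Aᴿ, A)` bounds `Σ_{m ≤ S} E(m) ≤ χ₁ + χ₂` (axial
  points of `box 4 S`), monotonicity gives `(j − 2R)·E(j) ≤ χ₁ + χ₂`, hence `0 ≤ D_A(j) ≤ (χ₁+χ₂)/(j − 2R) → 0` UNIFORMLY in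
  `S ≥ j`: mirror decorrelation at `β`;
* `noMirrorLongRangeOrder_of_finiteSusceptibility` / registered `stub_stub0OfCrux` — the crux implies STUB 0 (`β₀ ↦ max β₀ 0`);
  `weakCouplingDecorrelation_of_finiteSusceptibility`, `finiteSusceptibilityWeakCoupling_iff_subs` — the route-level split
  `Sub₀ ∧ Sub₁` is EQUIVALENT to the crux.

No definition is introduced; nothing here is a named fact. References: the line card `Lines/purity-rate-split.md`
(Lead instruction 3); K. Osterwalder, E. Seiler, Ann. Phys. 110 (1978) 440, §2. [folklore]
-/

noncomputable section

open MeasureTheory ProbabilityTheory Finset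
open Literature.MathematicalPhysics.QuantumFieldTheory hiding Site ZdEdge
open Literature.MathematicalPhysics.QuantumLattice
open Literature.Probability.LatticeModels hiding configShift configShift_apply

namespace Summit.QuantumFields.YangMills.Theorems.FiniteSusceptibilityWeakCoupling

namespace MirrorMonotone

open MirrorDominationAxis0 MirrorLogConvex

/-! ## §1 Real sequences: log-convex + symmetric ⇒ monotone; sums of log-convex sequences -/

/-- **Log-convex, non-negative and symmetric about `L/2 = S + ½` ⇒ non-increasing up to `S`.** If `E ≥ 0` on
`[a, L − a]` (`L = 2S+1`), `E(m)² ≤ E(m−1) E(m+1)` strictly inside, and `E(L − m) = E(m)`, then `E(m+1) ≤ E(m)` for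
`a ≤ m < S`: otherwise `0 < E(m) < E(m+1)` and the strict increase propagates by log-convexity up to
`E(S) < E(S+1) = E(L − (S+1)) = E(S)`. [folklore] -/
theorem antitone_step_of_logConvex_symm {E : ℕ → ℝ} {a S : ℕ}
    (h0 : ∀ m, a ≤ m → m + a ≤ 2 * S + 1 → 0 ≤ E m)
    (hlc : ∀ m, a < m → m + a < 2 * S + 1 → E m ^ 2 ≤ E (m - 1) * E (m + 1))
    (hsymm : ∀ m, m ≤ 2 * S + 1 → E (2 * S + 1 - m) = E m) :
    ∀ m, a ≤ m → m < S → E (m + 1) ≤ E m := by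
  intro m ham hmS
  by_contra hlt
  push Not at hlt
  -- `0 < E m`
  have hEm : 0 < E m := by
    rcases (h0 m ham (by omega)).lt_or_eq with h | h
    · exact h
    · exfalso
      have h1 := hlc (m + 1) (by omega) (by omega)
      rw [Nat.add_sub_cancel, ← h, zero_mul] at h1
      have h2 : E (m + 1) = 0 := pow_eq_zero_iff (n := 2) (by norm_num) |>.1 (le_antisymm h1 (sq_nonneg _))
      rw [h2, ← h] at hlt
      exact lt_irrefl _ hlt
  -- propagation of the strict increase
  have key : ∀ k, m + k ≤ S → 0 < E (m + k) ∧ E (m + k) < E (m + k + 1) := by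
    intro k
    induction k with
    | zero => intro _; exact ⟨hEm, hlt⟩
    | succ k ih =>
      intro hk
      obtain ⟨hpos, hinc⟩ := ih (by omega)
      have hpos1 : 0 < E (m + k + 1) := hpos.trans hinc
      have hl := hlc (m + k + 1) (by omega) (by omega)
      rw [Nat.add_sub_cancel] at hl
      have h2 : 0 ≤ E (m + k + 2) := h0 (m + k + 2) (by omega) (by omega)
      have hpos2 : 0 < E (m + k + 2) := by
        rcases h2.lt_or_eq with h | h
        · exact h
        · exfalso; rw [← h, mul_zero] at hl; nlinarith
      refine ⟨by simpa [add_assoc] using hpos1, ?_⟩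
      have h3 : E (m + k) * E (m + k + 2) < E (m + k + 1) * E (m + k + 2) :=
        mul_lt_mul_of_pos_right hinc hpos2
      have h4 : E (m + k + 1) ^ 2 < E (m + k + 1) * E (m + k + 2) := hl.trans_lt h3
      have h5 : E (m + k + 1) < E (m + k + 2) := by
        by_contra h6; push Not at h6; nlinarith
      simpa [add_assoc] using h5
  obtain ⟨-, hS⟩ := key (S - m) (by omega)
  have hSm : m + (S - m) = S := by omega
  rw [hSm] at hS
  have := hsymm (S + 1) (by omega)
  rw [show 2 * S + 1 - (S + 1) = S by omega] at this
  rw [← this] at hS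
  exact lt_irrefl _ hS

/-- From the one-step inequalities: `E(m) ≤ E(i)` for `a ≤ i ≤ m ≤ S`. [folklore] -/
theorem le_of_antitone_step {E : ℕ → ℝ} {a S : ℕ} (h : ∀ m, a ≤ m → m < S → E (m + 1) ≤ E m)
    {i m : ℕ} (hi : a ≤ i) (him : i ≤ m) (hm : m ≤ S) : E m ≤ E i := by
  induction m, him using Nat.le_induction with
  | base => exact le_rfl
  | succ n hn ih => exact (h n (hi.trans hn) (by omega)).trans (ih (by omega))

/-- **Monotone tail bound**: if `E(m) ≤ E(i)` for `a ≤ i ≤ m`, then `(m + 1 − a) E(m) ≤ Σ_{i ∈ [a, m]} E(i)`. [folklore] -/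
theorem card_mul_le_sum_of_le {E : ℕ → ℝ} {a m : ℕ} (h : ∀ i, a ≤ i → i ≤ m → E m ≤ E i) :
    ((m + 1 - a : ℕ) : ℝ) * E m ≤ ∑ i ∈ Ico a (m + 1), E i := by
  have hc : (Ico a (m + 1)).card = m + 1 - a := Nat.card_Ico a (m + 1)
  calc ((m + 1 - a : ℕ) : ℝ) * E m = ∑ _i ∈ Ico a (m + 1), E m := by
        rw [sum_const, hc, nsmul_eq_mul]
    _ ≤ ∑ i ∈ Ico a (m + 1), E i := sum_le_sum fun i hi => by
        rw [mem_Ico] at hi; exact h i hi.1 (by omega)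

/-- **Sums of non-negative log-convex triples are log-convex**: `x² ≤ x₋x₊`, `y² ≤ y₋y₊` with all terms `≥ 0` give
`(x + y)² ≤ (x₋ + y₋)(x₊ + y₊)` whenever `x₋, x₊, y₋, y₊ ≥ 0` (the cross term by
`(2xy)² ≤ 4 (x₋y₊)(y₋x₊) ≤ (x₋y₊ + y₋x₊)²`). [folklore] -/
theorem add_sq_le_of_sq_le {x xm xp y ym yp : ℝ} (hx : x ^ 2 ≤ xm * xp) (hy : y ^ 2 ≤ ym * yp)
    (hxm : 0 ≤ xm) (hxp : 0 ≤ xp) (hym : 0 ≤ ym) (hyp : 0 ≤ yp) :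
    (x + y) ^ 2 ≤ (xm + ym) * (xp + yp) := by
  have hcross : 2 * x * y ≤ xm * yp + ym * xp := by
    have h1 : (2 * x * y) ^ 2 ≤ (xm * yp + ym * xp) ^ 2 := by
      have : (x * y) ^ 2 ≤ (xm * yp) * (ym * xp) := by
        calc (x * y) ^ 2 = x ^ 2 * y ^ 2 := by ring
          _ ≤ (xm * xp) * (ym * yp) := mul_le_mul hx hy (sq_nonneg _) (by positivity)
          _ = (xm * yp) * (ym * xp) := by ring
      nlinarith [sq_nonneg (xm * yp - ym * xp)]
    exact abs_le_of_sq_le_sq' h1 (by positivity) |>.2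
  nlinarith

/-- Axial points of the box: `Σ_{m ≤ S} f(m e₀) ≤ Σ_{x ∈ box 4 S} f(x)` for `f ≥ 0`. [folklore] -/
theorem sum_axial_le_sum_box {f : Site 4 → ℝ} (hf : ∀ x, 0 ≤ f x) (S : ℕ) :
    ∑ m ∈ range (S + 1), f (Pi.single 0 (m : ℤ)) ≤ ∑ x ∈ box 4 S, f x := by
  have hinj : Set.InjOn (fun m : ℕ => (Pi.single 0 (m : ℤ) : Site 4)) ↑(range (S + 1)) := by
    intro m _ m' _ h
    have := congr_fun h 0
    simpa using this
  rw [← sum_image hinj]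
  refine sum_le_sum_of_subset_of_nonneg (fun x hx => ?_) (fun x _ _ => hf x)
  obtain ⟨m, hm, rfl⟩ := mem_image.1 hx
  rw [mem_range] at hm
  rw [mem_box]
  intro i
  by_cases hi : i = 0
  · subst hi; simp; omega
  · simp [hi]

/-! ## §2 Finite susceptibility at `β` forces mirror decorrelation at `β` -/

section Assembly

variable {G : Type} [Group G] [TopologicalSpace G] [IsTopologicalGroup G] [CompactSpace G]
  [MeasurableSpace G] [BorelSpace G]

/-- **The susceptibility clause at `β` implies mirror decorrelation at `β`** (every compact `G`, every `β ≥ 0`). If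
`Σ_{x ∈ box 4 S} |Cov_S(P∘lift, Q∘τ_x∘lift)| ≤ χ(P, Q)` for all `S` (used for the two pairs `(A, Aᴿ)`, `(Aᴿ, A)` only), then
for every `ε > 0` there is `j₀` with `|D_A(j)| ≤ ε` for all `j₀ ≤ j ≤ S`, on EVERY odd torus `2S+1`. Proof: the symmetrised
mirror function `E(m) = D_A(m) + D_A(L−m)` is non-negative, step-one log-convex and symmetric about `L/2` (§3–§4), hence
non-increasing on `[2R+1, S]` (`antitone_step_of_logConvex_symm`); the clause bounds `Σ_{m ≤ S} E(m) ≤ χ₁ + χ₂` through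
the axial points `±m e₀` of the box; so `(j − 2R)·D_A(j) ≤ (j − 2R)·E(j) ≤ χ₁ + χ₂`, and `j₀ = 2R + 1 + ⌈(χ₁+χ₂)/ε⌉`
works. [folklore] -/
theorem mirrorDecorrelation_of_fsClause (r : LatticeRep G) {β : ℝ} (hβ : 0 ≤ β)
    (hFS : ∀ A B : YMSpecies G, ∃ χ : ℝ, ∀ S : ℕ,
      ∑ x ∈ box 4 S, |cov[fun U => A.F (torusLift (2 * S + 1) U),
        fun U => B.F (configShift (-x) (torusLift (2 * S + 1) U));
        wilsonMeasure (d := 4) (L := 2 * S + 1) r.ρ β]| ≤ χ)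
    (A : YMSpecies G) {ε : ℝ} (hε : 0 < ε) :
    ∃ j₀ : ℕ, ∀ S j : ℕ, j₀ ≤ j → j ≤ S →
      |latticeConnectedCorr r.ρ β (2 * S + 1) A.F (fun V => A.F (cfgReflect V)) j| ≤ ε := by
  -- the time extent `R` of `A` (and of `Aᴿ`)
  obtain ⟨R, hRA, hRA3⟩ : ∃ R : ℕ, (∀ e ∈ A.supp, (e.1 0).natAbs + 2 ≤ R) ∧
      ∀ e ∈ A.supp, (e.1 0).natAbs + (2 + 1) ≤ R := by
    refine ⟨(A.supp.sup fun e => (e.1 0).natAbs) + 3, fun e he => ?_, fun e he => ?_⟩ <;>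
    · have := Finset.le_sup (f := fun e : ZdEdge 4 => (e.1 0).natAbs) he
      omega
  have hRR : ∀ e ∈ (reflSpecies A).supp, (e.1 0).natAbs + 2 ≤ R := radius_reflSpecies A (k := 2) hRA3
  obtain ⟨χ₁, hχ₁⟩ := hFS A (reflSpecies A)
  obtain ⟨χ₂, hχ₂⟩ := hFS (reflSpecies A) A
  -- the axial sums are bounded by `χ₁`, `χ₂`
  have hax₁ : ∀ S : ℕ, ∑ i ∈ range (S + 1),
      |latticeConnectedCorr r.ρ β (2 * S + 1) A.F (fun V => A.F (cfgReflect V)) i| ≤ χ₁ := by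
    intro S
    haveI : IsProbabilityMeasure (wilsonMeasure (d := 4) (L := 2 * S + 1) r.ρ β) :=
      isProbabilityMeasure_wilsonMeasure _ r.continuous β
    calc ∑ i ∈ range (S + 1), |latticeConnectedCorr r.ρ β (2 * S + 1) A.F (fun V => A.F (cfgReflect V)) i|
        = ∑ i ∈ range (S + 1), |cov[fun U => A.F (torusLift (2 * S + 1) U),
            fun U => (reflSpecies A).F (configShift (-(Pi.single 0 (i : ℤ) : Site 4))
              (torusLift (2 * S + 1) U)); wilsonMeasure (d := 4) (L := 2 * S + 1) r.ρ β]| :=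
          sum_congr rfl fun i _ =>
            congrArg abs (SiblingFunnel.covariance_eq_latticeConnectedCorr r β A (reflSpecies A) S i).symm
      _ ≤ ∑ x ∈ box 4 S, |cov[fun U => A.F (torusLift (2 * S + 1) U),
            fun U => (reflSpecies A).F (configShift (-x) (torusLift (2 * S + 1) U));
            wilsonMeasure (d := 4) (L := 2 * S + 1) r.ρ β]| :=
          sum_axial_le_sum_box (f := fun x => |cov[fun U => A.F (torusLift (2 * S + 1) U),
            fun U => (reflSpecies A).F (configShift (-x) (torusLift (2 * S + 1) U));
            wilsonMeasure (d := 4) (L := 2 * S + 1) r.ρ β]|) (fun x => abs_nonneg _) S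
      _ ≤ χ₁ := hχ₁ S
  have hax₂ : ∀ S : ℕ, ∑ i ∈ range (S + 1),
      |latticeConnectedCorr r.ρ β (2 * S + 1) (fun V => A.F (cfgReflect V)) A.F i| ≤ χ₂ := by
    intro S
    haveI : IsProbabilityMeasure (wilsonMeasure (d := 4) (L := 2 * S + 1) r.ρ β) :=
      isProbabilityMeasure_wilsonMeasure _ r.continuous β
    calc ∑ i ∈ range (S + 1), |latticeConnectedCorr r.ρ β (2 * S + 1) (fun V => A.F (cfgReflect V)) A.F i|
        = ∑ i ∈ range (S + 1), |cov[fun U => (reflSpecies A).F (torusLift (2 * S + 1) U),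
            fun U => A.F (configShift (-(Pi.single 0 (i : ℤ) : Site 4))
              (torusLift (2 * S + 1) U)); wilsonMeasure (d := 4) (L := 2 * S + 1) r.ρ β]| :=
          sum_congr rfl fun i _ =>
            congrArg abs (SiblingFunnel.covariance_eq_latticeConnectedCorr r β (reflSpecies A) A S i).symm
      _ ≤ ∑ x ∈ box 4 S, |cov[fun U => (reflSpecies A).F (torusLift (2 * S + 1) U),
            fun U => A.F (configShift (-x) (torusLift (2 * S + 1) U));
            wilsonMeasure (d := 4) (L := 2 * S + 1) r.ρ β]| :=
          sum_axial_le_sum_box (f := fun x => |cov[fun U => (reflSpecies A).F (torusLift (2 * S + 1) U),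
            fun U => A.F (configShift (-x) (torusLift (2 * S + 1) U));
            wilsonMeasure (d := 4) (L := 2 * S + 1) r.ρ β]|) (fun x => abs_nonneg _) S
      _ ≤ χ₂ := hχ₂ S
  have hχ : 0 ≤ χ₁ + χ₂ := by
    have h1 := (sum_nonneg fun i _ => abs_nonneg _).trans (hax₁ 0)
    have h2 := (sum_nonneg fun i _ => abs_nonneg _).trans (hax₂ 0)
    linarith
  refine ⟨2 * R + 1 + (⌈(χ₁ + χ₂) / ε⌉₊ + 1), fun S j hj hjS => ?_⟩
  -- the symmetrised mirror function on the torus `2S+1`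
  obtain ⟨E, hE⟩ : ∃ E : ℕ → ℝ, ∀ m, E m =
      latticeConnectedCorr r.ρ β (2 * S + 1) A.F (fun V => A.F (cfgReflect V)) m +
        latticeConnectedCorr r.ρ β (2 * S + 1) (fun V => A.F (cfgReflect V)) A.F m := ⟨_, fun _ => rfl⟩
  have h0C : ∀ m, 2 * R + 1 ≤ m → m + 2 * R ≤ 2 * S →
      0 ≤ latticeConnectedCorr r.ρ β (2 * S + 1) A.F (fun V => A.F (cfgReflect V)) m :=
    fun m h1 h2 => mirrorCorr_nonneg r hβ A hRA h1 h2
  have h0C' : ∀ m, 2 * R + 1 ≤ m → m + 2 * R ≤ 2 * S →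
      0 ≤ latticeConnectedCorr r.ρ β (2 * S + 1) (fun V => A.F (cfgReflect V)) A.F m := fun m h1 h2 => by
    rw [← mirrorCorr_reflSpecies]; exact mirrorCorr_nonneg r hβ (reflSpecies A) hRR h1 h2
  have hlC : ∀ m, 2 * R + 2 ≤ m → m + 2 * R + 1 ≤ 2 * S →
      latticeConnectedCorr r.ρ β (2 * S + 1) A.F (fun V => A.F (cfgReflect V)) m ^ 2 ≤
        latticeConnectedCorr r.ρ β (2 * S + 1) A.F (fun V => A.F (cfgReflect V)) (m - 1) *
          latticeConnectedCorr r.ρ β (2 * S + 1) A.F (fun V => A.F (cfgReflect V)) (m + 1) :=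
    fun m h1 h2 => mirrorCorr_sq_le r hβ A hRA h1 h2
  have hlC' : ∀ m, 2 * R + 2 ≤ m → m + 2 * R + 1 ≤ 2 * S →
      latticeConnectedCorr r.ρ β (2 * S + 1) (fun V => A.F (cfgReflect V)) A.F m ^ 2 ≤
        latticeConnectedCorr r.ρ β (2 * S + 1) (fun V => A.F (cfgReflect V)) A.F (m - 1) *
          latticeConnectedCorr r.ρ β (2 * S + 1) (fun V => A.F (cfgReflect V)) A.F (m + 1) :=
    fun m h1 h2 => by
      rw [← mirrorCorr_reflSpecies, ← mirrorCorr_reflSpecies, ← mirrorCorr_reflSpecies]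
      exact mirrorCorr_sq_le r hβ (reflSpecies A) hRR h1 h2
  have h0E : ∀ m, 2 * R + 1 ≤ m → m + (2 * R + 1) ≤ 2 * S + 1 → 0 ≤ E m := fun m h1 h2 => by
    rw [hE]; exact add_nonneg (h0C m h1 (by omega)) (h0C' m h1 (by omega))
  have hlE : ∀ m, 2 * R + 1 < m → m + (2 * R + 1) < 2 * S + 1 → E m ^ 2 ≤ E (m - 1) * E (m + 1) :=
    fun m h1 h2 => by
      rw [hE, hE, hE]
      exact add_sq_le_of_sq_le (hlC m (by omega) (by omega)) (hlC' m (by omega) (by omega))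
        (h0C (m - 1) (by omega) (by omega)) (h0C (m + 1) (by omega) (by omega))
        (h0C' (m - 1) (by omega) (by omega)) (h0C' (m + 1) (by omega) (by omega))
  have hsE : ∀ m, m ≤ 2 * S + 1 → E (2 * S + 1 - m) = E m := fun m hm => by
    rw [hE, hE, mirrorCorr_fold' r β A hm, ← mirrorCorr_fold r β A hm, add_comm]
  -- monotonicity and the tail bound
  have hstep := antitone_step_of_logConvex_symm h0E hlE hsE
  have htail : ((j + 1 - (2 * R + 1) : ℕ) : ℝ) * E j ≤ ∑ i ∈ Ico (2 * R + 1) (j + 1), E i :=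
    card_mul_le_sum_of_le fun i hi hij => le_of_antitone_step hstep hi hij hjS
  have hIco : ∑ i ∈ Ico (2 * R + 1) (j + 1), E i ≤ χ₁ + χ₂ := by
    calc ∑ i ∈ Ico (2 * R + 1) (j + 1), E i
        ≤ ∑ i ∈ Ico (2 * R + 1) (j + 1),
            (|latticeConnectedCorr r.ρ β (2 * S + 1) A.F (fun V => A.F (cfgReflect V)) i| +
              |latticeConnectedCorr r.ρ β (2 * S + 1) (fun V => A.F (cfgReflect V)) A.F i|) :=
          sum_le_sum fun i _ => by rw [hE]; exact add_le_add (le_abs_self _) (le_abs_self _)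
      _ ≤ ∑ i ∈ range (S + 1),
            (|latticeConnectedCorr r.ρ β (2 * S + 1) A.F (fun V => A.F (cfgReflect V)) i| +
              |latticeConnectedCorr r.ρ β (2 * S + 1) (fun V => A.F (cfgReflect V)) A.F i|) := by
          refine sum_le_sum_of_subset_of_nonneg (fun i hi => ?_) (fun i _ _ => by positivity)
          rw [mem_Ico] at hi
          exact mem_range.2 (by omega)
      _ ≤ χ₁ + χ₂ := by rw [sum_add_distrib]; exact add_le_add (hax₁ S) (hax₂ S)
  -- conclusion
  have hEj : E j ≤ ε := by
    have hn : (χ₁ + χ₂) / ε < ((j + 1 - (2 * R + 1) : ℕ) : ℝ) := by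
      have h1 : (χ₁ + χ₂) / ε ≤ ⌈(χ₁ + χ₂) / ε⌉₊ := Nat.le_ceil _
      have h2 : ((⌈(χ₁ + χ₂) / ε⌉₊ : ℕ) : ℝ) + 1 ≤ ((j + 1 - (2 * R + 1) : ℕ) : ℝ) := by
        exact_mod_cast (show ⌈(χ₁ + χ₂) / ε⌉₊ + 1 ≤ j + 1 - (2 * R + 1) by omega)
      linarith
    by_contra hlt
    push Not at hlt
    have h3 : (χ₁ + χ₂) / ε * ε < ((j + 1 - (2 * R + 1) : ℕ) : ℝ) * E j :=
      mul_lt_mul hn hlt.le hε (Nat.cast_nonneg _)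
    rw [div_mul_cancel₀ _ hε.ne'] at h3
    linarith
  have hCj : 0 ≤ latticeConnectedCorr r.ρ β (2 * S + 1) A.F (fun V => A.F (cfgReflect V)) j :=
    h0C j (by omega) (by omega)
  have hC'j : 0 ≤ latticeConnectedCorr r.ρ β (2 * S + 1) (fun V => A.F (cfgReflect V)) A.F j :=
    h0C' j (by omega) (by omega)
  rw [abs_of_nonneg hCj]
  have := hE j
  linarith

end Assembly

end MirrorMonotone

/-! ## §3 The crux implies STUB 0; the purity / rate cut is lossless -/

/-- **The crux implies STUB 0 of line `purity-rate-split`** (`NoMirrorLongRangeOrder`): finite susceptibility at every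
`β ≥ β₀(G, r)` forces, at every `β ≥ max β₀ 0`, every gauge-invariant local observable to decorrelate from its own
time-reflected image along the time axis, uniformly in the odd tori carrying the lag
(`MirrorMonotone.mirrorDecorrelation_of_fsClause`; reflection positivity only, every compact `G`). [folklore] -/
theorem noMirrorLongRangeOrder_of_finiteSusceptibility
    (h : Summit.QuantumFields.YangMills.Theses.FradkinShenkerFlow.FiniteSusceptibilityWeakCoupling) :
    ∀ (G : Type) [Group G] [TopologicalSpace G] [IsTopologicalGroup G] [CompactSpace G] [MeasurableSpace G]
      [BorelSpace G], IsCompactSimpleLieGroup G → ∀ r : LatticeRep G, ∃ β₀ : ℝ, ∀ β : ℝ, β₀ ≤ β →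
      ∀ A : YMSpecies G, ∀ ε : ℝ, 0 < ε → ∃ j₀ : ℕ, ∀ S j : ℕ, j₀ ≤ j → j ≤ S →
        |latticeConnectedCorr r.ρ β (2 * S + 1) A.F (fun V => A.F (cfgReflect V)) j| ≤ ε := by
  intro G _ _ _ _ _ _ hG r
  obtain ⟨β₀, hβ₀⟩ := h G hG r
  refine ⟨max β₀ 0, fun β hβ A ε hε => ?_⟩
  exact MirrorMonotone.mirrorDecorrelation_of_fsClause r ((le_max_right _ _).trans hβ)
    (hβ₀ β ((le_max_left _ _).trans hβ)) A hε

/-- **Registered sub-goal `stub_stub0OfCrux`** of item stmt-QuantumFields-9442 (signature verbatim, fully qualified):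
the crux implies the registered STUB 0 `stub_noMirrorLongRangeOrder` of line `purity-rate-split` — together with the
skeleton's `decorrelationForcesSummability_of_crux` (crux ⇒ STUB 1) and `finiteSusceptibilityWeakCoupling_of_stubs`
(STUB 0 ∧ STUB 1 ⇒ crux) the line's cut is an EQUIVALENCE. [folklore] -/
theorem stub_stub0OfCrux : Summit.QuantumFields.YangMills.Theses.FradkinShenkerFlow.FiniteSusceptibilityWeakCoupling → ∀ (G : Type) [Group G] [TopologicalSpace G] [IsTopologicalGroup G] [CompactSpace G] [MeasurableSpace G] [BorelSpace G], Literature.MathematicalPhysics.QuantumFieldTheory.IsCompactSimpleLieGroup G → ∀ r : Literature.MathematicalPhysics.QuantumFieldTheory.LatticeRep G, ∃ β₀ : ℝ, ∀ β : ℝ, β₀ ≤ β → ∀ A : Literature.MathematicalPhysics.QuantumFieldTheory.YMSpecies G, ∀ ε : ℝ, 0 < ε → ∃ j₀ : ℕ, ∀ S j : ℕ, j₀ ≤ j → j ≤ S → |Literature.MathematicalPhysics.QuantumFieldTheory.latticeConnectedCorr r.ρ β (2 * S + 1) A.F (fun V => A.F (Literature.MathematicalPhysics.QuantumFieldTheory.cfgReflect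 V)) j| ≤ ε :=
  noMirrorLongRangeOrder_of_finiteSusceptibility

open MirrorDominationAxis0 in
/-- **The crux implies `Sub₀` of the route-level split** (`WeakCouplingDecorrelation`: all PAIRS decorrelate along the time
axis at every `β ≥ β₀`, uniformly in the odd tori): mirror decorrelation of `A` and of `Aᴿ` (whose mirror correlator is the
swapped one, `mirrorCorr_reflSpecies`) feeds the landed `Split.decorrelation_of_mirrorDecorrelation`. [folklore] -/
theorem weakCouplingDecorrelation_of_finiteSusceptibility
    (h : Summit.QuantumFields.YangMills.Theses.FradkinShenkerFlow.FiniteSusceptibilityWeakCoupling) :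
    ∀ (G : Type) [Group G] [TopologicalSpace G] [IsTopologicalGroup G] [CompactSpace G] [MeasurableSpace G]
      [BorelSpace G], IsCompactSimpleLieGroup G → ∀ r : LatticeRep G, ∃ β₀ : ℝ, ∀ β : ℝ, β₀ ≤ β →
      ∀ A B : YMSpecies G, ∀ ε : ℝ, 0 < ε → ∃ n₀ : ℕ, ∀ S n : ℕ, n₀ ≤ n → n ≤ S →
        |latticeConnectedCorr r.ρ β (2 * S + 1) A.F B.F n| ≤ ε := by
  intro G _ _ _ _ _ _ hG r
  obtain ⟨β₀, hβ₀⟩ := h G hG r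
  refine ⟨max β₀ 0, fun β hβ => ?_⟩
  have hβ0 : (0 : ℝ) ≤ β := (le_max_right _ _).trans hβ
  have hFS := hβ₀ β ((le_max_left _ _).trans hβ)
  refine Split.decorrelation_of_mirrorDecorrelation r hβ0 fun A ε hε => ?_
  obtain ⟨j₁, hj₁⟩ := MirrorMonotone.mirrorDecorrelation_of_fsClause r hβ0 hFS A hε
  obtain ⟨j₂, hj₂⟩ := MirrorMonotone.mirrorDecorrelation_of_fsClause r hβ0 hFS (reflSpecies A) hε
  refine ⟨max j₁ j₂, fun S j hj hjS => ⟨hj₁ S j ((le_max_left _ _).trans hj) hjS, ?_⟩⟩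
  rw [← MirrorLogConvex.mirrorCorr_reflSpecies]
  exact hj₂ S j ((le_max_right _ _).trans hj) hjS

/-- **THE CUT IS LOSSLESS**: `FiniteSusceptibilityWeakCoupling ↔ Sub₀ ∧ Sub₁` with `Sub₀ = WeakCouplingDecorrelation` and
`Sub₁ = DecorrelationForcesSummability` exactly as in the landed `finiteSusceptibilityWeakCoupling_of_subs` (the
crux-strategist's decomposition of item stmt-QuantumFields-9442). `→`: this file and
`decorrelationForcesSummability_of_finiteSusceptibility`; `←`: `finiteSusceptibilityWeakCoupling_of_subs`. [folklore] -/
theorem finiteSusceptibilityWeakCoupling_iff_subs :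
    Summit.QuantumFields.YangMills.Theses.FradkinShenkerFlow.FiniteSusceptibilityWeakCoupling ↔
    ((∀ (G : Type) [Group G] [TopologicalSpace G] [IsTopologicalGroup G] [CompactSpace G] [MeasurableSpace G]
      [BorelSpace G], IsCompactSimpleLieGroup G → ∀ r : LatticeRep G, ∃ β₀ : ℝ, ∀ β : ℝ, β₀ ≤ β →
      ∀ A B : YMSpecies G, ∀ ε : ℝ, 0 < ε → ∃ n₀ : ℕ, ∀ S n : ℕ, n₀ ≤ n → n ≤ S →
        |latticeConnectedCorr r.ρ β (2 * S + 1) A.F B.F n| ≤ ε) ∧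
    (∀ (G : Type) [Group G] [TopologicalSpace G] [IsTopologicalGroup G] [CompactSpace G] [MeasurableSpace G]
      [BorelSpace G], IsCompactSimpleLieGroup G → ∀ r : LatticeRep G, ∃ β₀ : ℝ, ∀ β : ℝ, β₀ ≤ β →
      (∀ A B : YMSpecies G, ∀ ε : ℝ, 0 < ε → ∃ n₀ : ℕ, ∀ S n : ℕ, n₀ ≤ n → n ≤ S →
        |latticeConnectedCorr r.ρ β (2 * S + 1) A.F B.F n| ≤ ε) →
      ∀ A B : YMSpecies G, ∃ χ : ℝ, ∀ S : ℕ,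
        ∑ x ∈ box 4 S, |cov[fun U => A.F (torusLift (2 * S + 1) U),
          fun U => B.F (configShift (-x) (torusLift (2 * S + 1) U));
          wilsonMeasure (d := 4) (L := 2 * S + 1) r.ρ β]| ≤ χ)) :=
  ⟨fun h => ⟨weakCouplingDecorrelation_of_finiteSusceptibility h,
      decorrelationForcesSummability_of_finiteSusceptibility h⟩,
    fun h => finiteSusceptibilityWeakCoupling_of_subs h.1 h.2⟩

end Summit.QuantumFields.YangMills.Theorems.FiniteSusceptibilityWeakCoupling

end
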